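import Mathlib.RingTheory.Smooth.Locus
import Mathlib.RingTheory.Smooth.Basic
import Mathlib.RingTheory.Extension.Presentation.Submersive
import Mathlib.RingTheory.Polynomial.Basic
import Mathlib.RingTheory.MvPolynomial.Tower
import Mathlib.RingTheory.FinitePresentation
import Mathlib.RingTheory.Localization.Away.Basic
import Mathlib.RingTheory.Ideal.Quotient.Operations
import Mathlib.RingTheory.Spectrum.Prime.Topology
import Literature.AlgebraicGeometry.Resolution.StrictlyStandardSmooth
import Literature.AlgebraicGeometry.Resolution.StandardSmoothExtend
import Literature.AlgebraicGeometry.Resolution.SmoothStandardSmoothRetract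
import HarnessLib

/-!
# Stacks 07CP (the lifting lemma) for a smooth `C̄`

Topic: `Literature/AlgebraicGeometry/Resolution`. The Stacks Project, *Smoothing Ring Maps*
(Tag 07BW), §16.6 "The lifting lemma":

> **Lemma 07CP.** Let `R` be a Noetherian ring. Let `Λ` be an `R`-algebra. Let `π ∈ R` and
> assume that `Ann_R(π) = Ann_R(π²)` and `Ann_Λ(π) = Ann_Λ(π²)`. Suppose we have `R`-algebra
> maps `R/π²R → C̄ → Λ/π²Λ` with `C̄` of finite presentation. Then there exists an `R`-algebra
> homomorphism `D → Λ` and a commutative diagram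
> `R/π²R → C̄ → Λ/π²Λ` over `R/πR → D/πD → Λ/πΛ` with the following properties:
> (a) `D` is of finite presentation, (b) `R → D` is smooth at any prime `𝔮` with `π ∉ 𝔮`,
> (c) `R → D` is smooth at any prime `𝔮` with `π ∈ 𝔮` lying over a prime of `C̄` where
> `R/π²R → C̄` is smooth, and (d) `C̄/πC̄ → D/πD` is smooth at any prime lying over a prime of
> `C̄` where `R/π²R → C̄` is smooth.

This file PROVES the lemma in the case used by the proof of Popescu's theorem through Lemma
07F5 (`Stacks07F5_reduceToField_of`, hypothesis `hCP`, `NeronPopescuReduceToField.lean`):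
`C̄` *smooth* over `R/π²R`, with the conclusion "(b) + (c)" in the form "`D` is smooth over
`R`" (all primes are covered when the smooth locus of `R/π²R → C̄` is everything):

* `Stacks07CP_of_isStandardSmooth` — for `C̄` standard smooth over `R/π²R`;
* `Stacks07CP_of_smooth` — for `C̄` smooth over `R/π²R`, reduced to the standard smooth case
  by Lemma 07CH in retract form (`exists_isStandardSmooth_retract_of_smooth`,
  `SmoothStandardSmoothRetract.lean`); this is `hCP` verbatim.

## The printed proof in this case, and its formalisation

Stacks: choose a presentation `C̄ = R[x_1, …, x_n]/(f_1, …, f_m)`, elements `a_k` covering the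
smooth locus with `(Ī/Ī²)_{a_k}` free on `f_j, j ∈ E_k` (Lemma 07C6), relations (4)
`a_k f_ℓ = Σ h f_j + π² g`, and `D = R[x, z]/(f_j - π z_j, p_{k,ℓ})`; `D → Λ` by `x_i ↦ λ_i`,
`z_j ↦ π μ_j` where `f_j(λ) = π² μ_j`; `D[1/π] ≅ R[1/π][x]` gives (b); for (c), at primes over
`D(a_k)` one compares with `D_k` and uses Algebra, Lemmas 00SY and 00TF (syntomic by counting
equations, smooth by the fibre criterion).

When `C̄` is *standard* smooth over `R/π²R`, with presentation
`C̄ = (R/π²R)[x_1, …, x_N]/(f̄_1, …, f̄_c)` whose Jacobian minor `det(∂f̄_j/∂x_i)_{i,j ≤ c}` is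
invertible, the conormal module `Ī/Ī²` is free on *all* the `f̄_j`, so in the printed proof we
may take `r = 1`, `a_1 = 1`, `E_1 = {1, …, c}`; then `I_1 = I`, `h = δ`, `g = 0`, every
`p_{k,ℓ}` vanishes and

  `D = R[x_1, …, x_N, z_1, …, z_c]/(f_j - π z_j)`  (`Stacks07CP.D`, `f_j` lifts of the `f̄_j`),

`D → Λ`: `x_i ↦ λ_i`, `z_j ↦ π μ_j` (`Stacks07CP.δ`; no annihilator condition is needed since
there are no `p_{k,ℓ}`), `C̄ → D/πD`: `x_i ↦ x_i` (the map `ε`, built from the surjection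
`R[x] → C̄` with kernel `(f_j) + π²R[x]`). Smoothness of `D` over `R` is obtained without the
syntomic/fibre criteria: the Jacobian minor of the relations `f_j - π z_j` with respect to
`z_1, …, z_c` is `(-π)^c`, and with respect to `x_1, …, x_c` it is `Δ = det(∂f_j/∂x_i)`; both are
strictly standard in `D` (Definition 07C7: there are exactly `c` relations), so `D_{π^c}` and
`D_Δ` are smooth over `R` by Elkik's Lemma 07CA (`IsStrictlyStandard.smooth`,
`StrictlyStandardSmooth.lean`) — this replaces "(b) `D[1/π] ≅ R[1/π][x]`" and the local study
at primes containing `π` — and `(Δ, π) = D` because the image of `Δ` in `C̄`, a quotient of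
`D/πD`, is the invertible Jacobian; smoothness being local (`Algebra.basicOpen_subset_smoothLocus_iff`),
`D` is smooth. The commutativity of the diagram is checked on the generators `x_i`.

## References

* The Stacks Project, *Smoothing Ring Maps* (Tag 07BW): Lemma 07CP and its proof; Lemmas
  07C6, 07CA, 07CH, Definition 07C7. [StacksProject]
-/

noncomputable section

open MvPolynomial

namespace Literature.AlgebraicGeometry.Resolution

universe u

/-! ## Tools -/

section Tools

variable {R : Type u} [CommRing R]

/-- Smoothness is local on the target: if `(f_i) = D` and every `D_{f_i}` is smooth over `R`
then `D` is smooth over `R` (for `D` of finite presentation). [folklore] -/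
theorem smooth_of_span_range_eq_top {D : Type u} [CommRing D] [Algebra R D]
    [Algebra.FinitePresentation R D] {ι : Type*} (f : ι → D)
    (hf : Ideal.span (Set.range f) = ⊤)
    (h : ∀ i, Algebra.Smooth R (Localization.Away (f i))) : Algebra.Smooth R D := by
  refine ⟨?_, inferInstance⟩
  rw [← Algebra.smoothLocus_eq_univ_iff, ← Set.univ_subset_iff, ← TopologicalSpace.Opens.coe_top,
    ← PrimeSpectrum.iSup_basicOpen_eq_top_iff.mpr hf]
  simp only [TopologicalSpace.Opens.coe_iSup, Set.iUnion_subset_iff]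
  intro i
  rw [Algebra.basicOpen_subset_smoothLocus_iff]
  exact (h i).1

/-- A unit modulo `I` generates the unit ideal together with `I`. [folklore] -/
theorem span_singleton_sup_eq_top_of_isUnit_mk {D : Type u} [CommRing D] {I : Ideal D} {a : D}
    (h : IsUnit (Ideal.Quotient.mk I a)) : Ideal.span {a} ⊔ I = ⊤ := by
  obtain ⟨b, hb⟩ := h.exists_right_inv
  obtain ⟨b, rfl⟩ := Ideal.Quotient.mk_surjective b
  rw [← map_mul, ← map_one (Ideal.Quotient.mk I), Ideal.Quotient.eq] at hb
  rw [Ideal.eq_top_iff_one]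
  have : (1 : D) = a * b - (a * b - 1) := by ring
  rw [this]
  exact Ideal.sub_mem _ (Ideal.mem_sup_left (Ideal.mul_mem_right _ _ (Ideal.mem_span_singleton_self a)))
    (Ideal.mem_sup_right hb)

/-- Evaluation at the naive generators of `R[X]/(g)` is the quotient map. [folklore] -/
theorem aeval_naive_val {N c : ℕ} (g : Fin c → MvPolynomial (Fin N) R) (p : MvPolynomial (Fin N) R) :
    aeval (Algebra.Presentation.naive (v := g)).val p = Ideal.Quotient.mk (Ideal.span (Set.range g)) p := by
  have h : (aeval (Algebra.Presentation.naive (v := g)).val : MvPolynomial (Fin N) R →ₐ[R] _) =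
      Ideal.Quotient.mkₐ R (Ideal.span (Set.range g)) := by
    refine MvPolynomial.algHom_ext fun i => ?_
    rw [aeval_X]
    rfl
  exact AlgHom.congr_fun h p

/-- **Every `c × c` Jacobian minor of `c` relations is strictly standard** in
`R[X_1, …, X_N]/(g_1, …, g_c)` (Definition 07C7 with the naive presentation: condition
(16.2.3.3) with one nonzero coefficient, condition (16.2.3.4) void as there are exactly `c`
relations). [cite: StacksProject, Tag 07C7] -/
theorem isStrictlyStandard_mk_jacobianMinor {N c : ℕ} (g : Fin c → MvPolynomial (Fin N) R)
    (hcN : c ≤ N) (ι₀ : Fin c → Fin N) :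
    IsStrictlyStandard R (Ideal.Quotient.mk (Ideal.span (Set.range g)) (jacobianMinor g le_rfl ι₀)) := by
  classical
  refine ⟨N, c, Algebra.Presentation.naive (v := g), c, hcN, le_rfl,
    ⟨fun ι => if ι = ι₀ then 1 else 0, ?_⟩, ?_⟩
  · simp only [ite_mul, one_mul, zero_mul, Finset.sum_ite_eq', Finset.mem_univ, if_true]
    rw [aeval_naive_val]
    rfl
  · intro p _ j hj
    exact absurd hj (not_le.mpr j.isLt)

/-- `(R[X]/(g_1, …, g_c))_Δ` is smooth over `R` for every `c × c` Jacobian minor `Δ` of the `g_j`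
(Elkik's Lemma 07CA, `IsStrictlyStandard.smooth`). [cite: StacksProject, Tag 07CA] -/
theorem smooth_away_mk_jacobianMinor {N c : ℕ} (g : Fin c → MvPolynomial (Fin N) R)
    (hcN : c ≤ N) (ι₀ : Fin c → Fin N) :
    Algebra.Smooth R (Localization.Away
      (Ideal.Quotient.mk (Ideal.span (Set.range g)) (jacobianMinor g le_rfl ι₀))) :=
  (isStrictlyStandard_mk_jacobianMinor g hcN ι₀).smooth

end Tools

/-! ## The algebra `D = R[x, z]/(f_j - π z_j)` of the proof of 07CP -/

namespace Stacks07CP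

variable {R : Type u} [CommRing R] (π : R) {N c : ℕ} (f : Fin c → MvPolynomial (Fin N) R)

/-- The relations `F_j = f_j(x) - π z_j` in `R[x_1, …, x_N, z_1, …, z_c]` (variables
`x_i = X (castAdd c i)`, `z_j = X (natAdd N j)`). [cite: StacksProject, Tag 07CP (proof)] -/
def rel (j : Fin c) : MvPolynomial (Fin (N + c)) R :=
  rename (Fin.castAdd c) (f j) - C π * X (Fin.natAdd N j)

/-- The algebra `D = R[x_1, …, x_N, z_1, …, z_c]/(f_j - π z_j)` of the proof of 07CP (case
`r = 1`, `a_1 = 1`, `E_1 = {1, …, m}`, so that all `p_{k,ℓ}` vanish).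
[cite: StacksProject, Tag 07CP (proof)] -/
abbrev D : Type u := MvPolynomial (Fin (N + c)) R ⧸ Ideal.span (Set.range (rel π f))

/-- The quotient map `R[x, z] → D`. [cite: StacksProject, Tag 07CP (proof)] -/
abbrev mkD : MvPolynomial (Fin (N + c)) R →ₐ[R] D π f :=
  Ideal.Quotient.mkₐ R (Ideal.span (Set.range (rel π f)))

/-- `f_j(x) = π z_j` in `D`. [cite: StacksProject, Tag 07CP (proof)] -/
theorem mkD_rename_f (j : Fin c) :
    mkD π f (rename (Fin.castAdd c) (f j)) = algebraMap R (D π f) π * mkD π f (X (Fin.natAdd N j)) := by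
  have h : mkD π f (rel π f j) = 0 := Ideal.Quotient.eq_zero_iff_mem.mpr (Ideal.subset_span ⟨j, rfl⟩)
  rw [rel, map_sub, sub_eq_zero, map_mul] at h
  rw [h, Ideal.Quotient.mkₐ_eq_mk, ← Ideal.Quotient.algebraMap_eq, ← MvPolynomial.algebraMap_eq,
    ← IsScalarTower.algebraMap_apply]

/-- `D` is of finite presentation over `R`. [cite: StacksProject, Tag 07CP] -/
instance finitePresentation : Algebra.FinitePresentation R (D π f) :=
  Algebra.FinitePresentation.quotient (Submodule.fg_span (Set.finite_range _))

/-! ### The two Jacobian minors -/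

/-- The distinguished `x`-variables `x_1, …, x_c` inside `R[x, z]`. [cite: StacksProject, Tag 07CP (proof)] -/
def ιx (hcN : c ≤ N) : Fin c → Fin (N + c) := Fin.castAdd c ∘ Fin.castLE hcN

/-- The `z`-variables inside `R[x, z]`. [cite: StacksProject, Tag 07CP (proof)] -/
def ιz : Fin c → Fin (N + c) := Fin.natAdd N

/-- `x`-variables and `z`-variables are distinct. [folklore] -/
theorem castAdd_ne_natAdd (i : Fin N) (j : Fin c) : Fin.castAdd c i ≠ Fin.natAdd N j := by
  intro h
  have := congrArg Fin.val h
  simp only [Fin.val_castAdd, Fin.val_natAdd] at this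
  omega

/-- `∂F_j/∂x_i = ∂f_j/∂x_i`. [cite: StacksProject, Tag 07CP (proof)] -/
theorem pderiv_castAdd_rel (i : Fin N) (j : Fin c) :
    pderiv (Fin.castAdd c i) (rel π f j) = rename (Fin.castAdd c) (pderiv i (f j)) := by
  classical
  rw [rel, map_sub, pderiv_rename (Fin.castAdd_injective N c), pderiv_C_mul,
    pderiv_X, Pi.single_apply, if_neg (castAdd_ne_natAdd i j).symm, mul_zero, sub_zero]

/-- `∂F_j/∂z_i = -π δ_{ij}`. [cite: StacksProject, Tag 07CP (proof)] -/
theorem pderiv_natAdd_rel (i j : Fin c) :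
    pderiv (Fin.natAdd N i) (rel π f j) = if j = i then -C π else 0 := by
  classical
  rw [rel, map_sub, pderiv_eq_zero_of_notMem_vars, zero_sub, pderiv_C_mul, pderiv_X, Pi.single_apply]
  · by_cases h : j = i
    · subst h; simp
    · rw [if_neg (fun h' => h ((Fin.natAdd_inj N).mp h')), if_neg h, mul_zero, neg_zero]
  · intro hmem
    obtain ⟨k, -, hk⟩ := Finset.mem_image.mp (vars_rename _ _ hmem)
    exact castAdd_ne_natAdd k i hk

/-- The Jacobian minor of the `F_j` with respect to `x_1, …, x_c` is the one of the `f_j`.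
[cite: StacksProject, Tag 07CP (proof)] -/
theorem jacobianMinor_ιx (hcN : c ≤ N) :
    jacobianMinor (rel π f) le_rfl (ιx hcN) =
      rename (Fin.castAdd c) (jacobianMinor f le_rfl (Fin.castLE hcN)) := by
  unfold jacobianMinor
  rw [AlgHom.map_det]
  congr 1
  ext i j
  rw [AlgHom.mapMatrix_apply, Matrix.map_apply, Matrix.of_apply, Matrix.of_apply, ιx,
    Function.comp_apply, pderiv_castAdd_rel]

/-- The Jacobian minor of the `F_j` with respect to `z_1, …, z_c` is `(-π)^c`.
[cite: StacksProject, Tag 07CP (proof)] -/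
theorem jacobianMinor_ιz : jacobianMinor (rel π f) le_rfl (ιz (N := N)) = (-C π) ^ c := by
  unfold jacobianMinor
  have h : (Matrix.of fun i j : Fin c => pderiv (ιz (N := N) i) (rel π f (Fin.castLE le_rfl j))) =
      (-C π : MvPolynomial (Fin (N + c)) R) • (1 : Matrix (Fin c) (Fin c) (MvPolynomial (Fin (N + c)) R)) := by
    ext i j
    rw [Matrix.of_apply, ιz, pderiv_natAdd_rel, Matrix.smul_apply, Matrix.one_apply, smul_eq_mul,
      mul_ite, mul_one, mul_zero]
    simp only [Fin.castLE_rfl, id_eq, eq_comm]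
  rw [h, Matrix.det_smul, Matrix.det_one, mul_one, Fintype.card_fin]

/-- `D_{Δ}` is smooth over `R` for every Jacobian minor `Δ` of the `F_j` (Elkik, Stacks 07CA).
[cite: StacksProject, Tag 07CA] -/
theorem smooth_away_minor (hcN : c ≤ N) (ι₀ : Fin c → Fin (N + c)) :
    Algebra.Smooth R (Localization.Away (mkD π f (jacobianMinor (rel π f) le_rfl ι₀))) :=
  smooth_away_mk_jacobianMinor (rel π f) (hcN.trans (Nat.le_add_right N c)) ι₀

/-- The image `Δ_x ∈ D` of the Jacobian minor with respect to `x_1, …, x_c`. [cite: StacksProject, Tag 07CP (proof)] -/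
def Δx (hcN : c ≤ N) : D π f := mkD π f (jacobianMinor (rel π f) le_rfl (ιx hcN))

/-- The image `Δ_z = (-π)^c ∈ D` of the Jacobian minor with respect to the `z_j`. [cite: StacksProject, Tag 07CP (proof)] -/
def Δz : D π f := mkD π f (jacobianMinor (rel π f) le_rfl (ιz (N := N)))

/-- `Δ_z = (-π)^c`. [cite: StacksProject, Tag 07CP (proof)] -/
theorem Δz_eq : Δz π f = (-algebraMap R (D π f) π) ^ c := by
  rw [Δz, jacobianMinor_ιz, map_pow, map_neg]
  rfl

/-- **`D` is smooth over `R`** as soon as `Δ_x` is a unit modulo `π`: `Spec D = D(Δ_x) ∪ D(π^c)`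
and both opens are smooth by Elkik's lemma. [cite: StacksProject, Tag 07CP (proof)] -/
theorem smooth (hcN : c ≤ N)
    (hunit : IsUnit (Ideal.Quotient.mk ((Ideal.span {π}).map (algebraMap R (D π f))) (Δx π f hcN))) :
    Algebra.Smooth R (D π f) := by
  have hsup : Ideal.span {Δx π f hcN} ⊔ (Ideal.span {π}).map (algebraMap R (D π f)) = ⊤ :=
    span_singleton_sup_eq_top_of_isUnit_mk hunit
  rw [Ideal.map_span, Set.image_singleton] at hsup
  have hsup' := Ideal.sup_pow_eq_top (n := c) hsup
  rw [Ideal.span_singleton_pow] at hsup'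
  have htop : Ideal.span (Set.range ![Δx π f hcN, Δz π f]) = ⊤ := by
    rw [eq_top_iff, ← hsup', sup_le_iff]
    constructor
    · apply Ideal.span_mono
      rintro _ rfl
      exact ⟨0, rfl⟩
    · rw [Ideal.span_singleton_le_iff_mem, Ideal.mem_span]
      intro J hJ
      have hz : Δz π f ∈ J := hJ ⟨1, rfl⟩
      rw [Δz_eq] at hz
      have h1 : algebraMap R (D π f) π ^ c = (-1) ^ c * (-algebraMap R (D π f) π) ^ c := by
        rw [← mul_pow]; ring
      rw [h1]
      exact J.mul_mem_left _ hz
  refine smooth_of_span_range_eq_top _ htop fun i => ?_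
  fin_cases i
  · exact smooth_away_minor π f hcN (ιx hcN)
  · exact smooth_away_minor π f hcN ιz

/-! ### The map `D → Λ` -/

variable {Λ : Type u} [CommRing Λ] [Algebra R Λ] (lam : Fin N → Λ) (μ : Fin c → Λ)
  (hμ : ∀ j, aeval lam (f j) = algebraMap R Λ π * (algebraMap R Λ π * μ j))

/-- The map `δ : D → Λ`, `x_i ↦ λ_i`, `z_j ↦ π μ_j`, where `f_j(λ) = π² μ_j`.
[cite: StacksProject, Tag 07CP (proof)] -/
def δ : D π f →ₐ[R] Λ :=
  Ideal.Quotient.liftₐ _ (aeval (Fin.addCases lam fun j => algebraMap R Λ π * μ j)) (by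
    intro p hp
    refine Submodule.span_induction ?_ (map_zero _)
      (fun a b _ _ ha hb => by rw [map_add, ha, hb, add_zero])
      (fun a b _ hb => by rw [smul_eq_mul, map_mul, hb, mul_zero]) hp
    rintro _ ⟨j, rfl⟩
    rw [rel, map_sub, aeval_rename, map_mul, aeval_X, aeval_C, Fin.addCases_right, sub_eq_zero]
    have hcomp : (Fin.addCases lam fun j => algebraMap R Λ π * μ j) ∘ Fin.castAdd c = lam := by
      funext i; simp
    rw [hcomp, hμ])

/-- `δ` on representatives. [cite: StacksProject, Tag 07CP (proof)] -/
theorem δ_mkD (p : MvPolynomial (Fin (N + c)) R) :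
    δ π f lam μ hμ (mkD π f p) = aeval (Fin.addCases lam fun j => algebraMap R Λ π * μ j) p := rfl

/-- `δ(x_i) = λ_i`. [cite: StacksProject, Tag 07CP (proof)] -/
theorem δ_x (i : Fin N) : δ π f lam μ hμ (mkD π f (X (Fin.castAdd c i))) = lam i := by
  rw [δ_mkD, aeval_X, Fin.addCases_left]

end Stacks07CP

/-! ## Stacks 07CP for a standard smooth `C̄` -/

section Main

variable {R Λ : Type u} [CommRing R] [CommRing Λ] [Algebra R Λ] (π : R)

/-- Jacobian minors commute with coefficient maps. [folklore] -/
theorem map_jacobianMinor {S : Type u} [CommRing S] (φ : R →+* S) {n m : ℕ}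
    (f : Fin m → MvPolynomial (Fin n) R) {c : ℕ} (hc : c ≤ m) (ι : Fin c → Fin n) :
    MvPolynomial.map φ (jacobianMinor f hc ι) = jacobianMinor (fun j => MvPolynomial.map φ (f j)) hc ι := by
  unfold jacobianMinor
  rw [RingHom.map_det]
  congr 1
  ext i j
  rw [RingHom.mapMatrix_apply, Matrix.map_apply, Matrix.of_apply, Matrix.of_apply, pderiv_map]

/-- **Stacks, Lemma 07CP (the lifting lemma), for `C̄` standard smooth over `R/π²R`.** Given
`R`-algebra maps `R/π²R → C̄ → Λ/π²Λ` with `C̄` standard smooth over `R/π²R`, there are a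
smooth `R`-algebra `D`, an `R`-algebra map `δ : D → Λ` and an `R`-algebra map
`ε : C̄ → D/πD` making the diagram of 07CP commute (`D/πD → Λ/πΛ` induced by `δ`). In the printed
proof, for `C̄` standard smooth one may take `r = 1`, `a_1 = 1`, `E_1 = {1, …, m}` (the conormal
module is free on all the relations), so that `D = R[x, z]/(f_j - π z_j)`; smoothness of `D`:
`D_π ≅ R_π[x]` ((b) of 07CP) and `D_{Δ}` with `Δ` the Jacobian minor of the `f_j` are smooth by
Elkik's Lemma 07CA (`(-π)^c` and `Δ` are strictly standard in `D`), and `(Δ, π) = D` because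
`Δ` is a unit in `C̄`, a quotient of `D/πD`. No Noetherian or annihilator hypothesis is needed in
this case. [cite: StacksProject, Tag 07CP] -/
theorem Stacks07CP_of_isStandardSmooth
    (Cb : Type u) [CommRing Cb] [Algebra R Cb] [Algebra (R ⧸ Ideal.span {π ^ 2}) Cb]
    [IsScalarTower R (R ⧸ Ideal.span {π ^ 2}) Cb]
    [Algebra.IsStandardSmooth (R ⧸ Ideal.span {π ^ 2}) Cb]
    (γ : Cb →ₐ[R] Λ ⧸ (Ideal.span {π ^ 2}).map (algebraMap R Λ)) :
    ∃ (D : Type u) (_ : CommRing D) (_ : Algebra R D), Algebra.Smooth R D ∧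
      ∃ (δ : D →ₐ[R] Λ) (ε : Cb →ₐ[R] D ⧸ (Ideal.span {π}).map (algebraMap R D)),
        ∀ (c : Cb) (d : D) (l : Λ), Ideal.Quotient.mk _ d = ε c → Ideal.Quotient.mk _ l = γ c →
          Ideal.Quotient.mk ((Ideal.span {π}).map (algebraMap R Λ)) (δ d) =
            Ideal.Quotient.mk ((Ideal.span {π}).map (algebraMap R Λ)) l := by
  classical
  -- a submersive presentation with `Fin` indices, the distinguished variables first
  obtain ⟨N, c, -, hcN, P, -, hmap⟩ :=
    exists_submersivePresentation_fin_extend (R := R ⧸ Ideal.span {π ^ 2}) (A := Cb) (n := 0)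
      Fin.elim0
  -- lifts of the relations to `R[x]`
  have hsurj : Function.Surjective
      (MvPolynomial.map (σ := Fin N) (algebraMap R (R ⧸ Ideal.span {π ^ 2}))) :=
    map_surjective _ Ideal.Quotient.mk_surjective
  choose f hf using fun j => hsurj (P.relation j)
  -- `θ : R[x] → C̄`
  let θ : MvPolynomial (Fin N) R →ₐ[R] Cb := aeval P.val
  have hθ : ∀ p, θ p = aeval P.val (MvPolynomial.map (algebraMap R (R ⧸ Ideal.span {π ^ 2})) p) :=
    fun p => (aeval_map_algebraMap (R ⧸ Ideal.span {π ^ 2}) P.val p).symm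
  have hθf : ∀ j, θ (f j) = 0 := fun j => by rw [hθ, hf]; exact P.aeval_val_relation j
  have hθsurj : Function.Surjective θ := fun c₀ => by
    obtain ⟨q, hq⟩ := P.aeval_val_surjective c₀
    obtain ⟨p, rfl⟩ := hsurj q
    exact ⟨p, by rw [hθ, hq]⟩
  -- lifts `λ_i` of `γ(x_i)` and the elements `μ_j` with `f_j(λ) = π² μ_j`
  choose lam hlam using fun i => Ideal.Quotient.mk_surjective (γ (P.val i))
  have hkey : (Ideal.Quotient.mkₐ R ((Ideal.span {π ^ 2}).map (algebraMap R Λ))).comp (aeval lam) =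
      γ.comp θ := by
    refine MvPolynomial.algHom_ext fun i => ?_
    rw [AlgHom.comp_apply, AlgHom.comp_apply, aeval_X, Ideal.Quotient.mkₐ_eq_mk, hlam]
    change _ = γ (aeval P.val (X i))
    rw [aeval_X]
  have hfl : ∀ j, aeval lam (f j) ∈ (Ideal.span {π ^ 2}).map (algebraMap R Λ) := fun j => by
    rw [← Ideal.Quotient.eq_zero_iff_mem, ← Ideal.Quotient.mkₐ_eq_mk R, ← AlgHom.comp_apply, hkey,
      AlgHom.comp_apply, hθf, map_zero]
  have hμex : ∀ j, ∃ μ : Λ, aeval lam (f j) = algebraMap R Λ π * (algebraMap R Λ π * μ) := fun j => by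
    have h := hfl j
    rw [Ideal.map_span, Set.image_singleton, Ideal.mem_span_singleton'] at h
    obtain ⟨μ, hμ⟩ := h
    exact ⟨μ, by rw [← hμ, map_pow]; ring⟩
  choose μ hμ using hμex
  -- the algebra `D`, the map `δ`
  refine ⟨Stacks07CP.D π f, inferInstance, inferInstance, ?_⟩
  set πD : Ideal (Stacks07CP.D π f) := (Ideal.span {π}).map (algebraMap R (Stacks07CP.D π f)) with hπD
  have hπmem : algebraMap R (Stacks07CP.D π f) π ∈ πD :=
    Ideal.mem_map_of_mem _ (Ideal.mem_span_singleton_self π)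
  -- `ε₁ : R[x] → D/πD`
  let ε₁ : MvPolynomial (Fin N) R →ₐ[R] Stacks07CP.D π f ⧸ πD :=
    (Ideal.Quotient.mkₐ R πD).comp ((Stacks07CP.mkD π f).comp (rename (Fin.castAdd c)))
  have hε₁ : ∀ p, ε₁ p = Ideal.Quotient.mk πD (Stacks07CP.mkD π f (rename (Fin.castAdd c) p)) :=
    fun p => rfl
  have hε₁f : ∀ j, ε₁ (f j) = 0 := fun j => by
    rw [hε₁, Stacks07CP.mkD_rename_f, Ideal.Quotient.eq_zero_iff_mem]
    exact Ideal.mul_mem_right _ _ hπmem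
  have hε₁C : ε₁ (C (π ^ 2)) = 0 := by
    rw [← MvPolynomial.algebraMap_eq, AlgHom.commutes, IsScalarTower.algebraMap_apply R
      (Stacks07CP.D π f) (Stacks07CP.D π f ⧸ πD), Ideal.Quotient.algebraMap_eq, map_pow, pow_two,
      Ideal.Quotient.eq_zero_iff_mem]
    exact Ideal.mul_mem_left _ _ hπmem
  -- `ker θ ≤ ker ε₁`
  have hker : RingHom.ker θ.toRingHom ≤ RingHom.ker ε₁.toRingHom := by
    intro p hp
    rw [RingHom.mem_ker, AlgHom.toRingHom_eq_coe, AlgHom.coe_toRingHom, hθ] at hp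
    have hp' : MvPolynomial.map (algebraMap R (R ⧸ Ideal.span {π ^ 2})) p ∈
        (Ideal.span (Set.range f)).map
          (MvPolynomial.map (σ := Fin N) (algebraMap R (R ⧸ Ideal.span {π ^ 2}))) := by
      rw [Ideal.map_span, ← Set.range_comp]
      have : (MvPolynomial.map (algebraMap R (R ⧸ Ideal.span {π ^ 2}))) ∘ f = P.relation :=
        funext hf
      rw [this, P.span_range_relation_eq_ker, P.ker_eq_ker_aeval_val, RingHom.mem_ker]
      exact hp
    obtain ⟨q, hq, hqp⟩ := (Ideal.mem_map_iff_of_surjective _ hsurj).mp hp'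
    have hdiff : p - q ∈ Ideal.span {(C (π ^ 2) : MvPolynomial (Fin N) R)} := by
      have h1 : p - q ∈ RingHom.ker (MvPolynomial.map (σ := Fin N)
          (algebraMap R (R ⧸ Ideal.span {π ^ 2}))) := by
        rw [RingHom.mem_ker, map_sub, hqp, sub_self]
      rwa [ker_map, Ideal.Quotient.algebraMap_eq, Ideal.mk_ker, Ideal.map_span,
        Set.image_singleton] at h1
    have hq0 : ε₁ q = 0 := by
      have : Ideal.span (Set.range f) ≤ RingHom.ker ε₁.toRingHom := by
        rw [Ideal.span_le]
        rintro _ ⟨j, rfl⟩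
        exact hε₁f j
      exact this hq
    have hpq0 : ε₁ (p - q) = 0 := by
      have : Ideal.span {(C (π ^ 2) : MvPolynomial (Fin N) R)} ≤ RingHom.ker ε₁.toRingHom := by
        rw [Ideal.span_le, Set.singleton_subset_iff]
        exact hε₁C
      exact this hdiff
    rw [RingHom.mem_ker, AlgHom.toRingHom_eq_coe, AlgHom.coe_toRingHom]
    have : p = q + (p - q) := by ring
    rw [this, map_add, hq0, hpq0, add_zero]
  -- `ε : C̄ → D/πD`
  let ε₀ : Cb →+* Stacks07CP.D π f ⧸ πD := θ.toRingHom.liftOfSurjective hθsurj ⟨ε₁.toRingHom, hker⟩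
  have hε₀ : ∀ p, ε₀ (θ p) = ε₁ p := fun p =>
    θ.toRingHom.liftOfSurjective_comp_apply hθsurj ⟨ε₁.toRingHom, hker⟩ p
  let ε : Cb →ₐ[R] Stacks07CP.D π f ⧸ πD := AlgHom.mk ε₀ fun r => by
    have h1 : θ (C r) = algebraMap R Cb r := aeval_C _ r
    have h2 := ε₁.commutes r
    rw [MvPolynomial.algebraMap_eq] at h2
    rw [← h2, ← hε₀, h1]
    rfl
  have hεθ : ∀ p, ε (θ p) = ε₁ p := hε₀
  -- smoothness of `D`: the Jacobian minor is a unit modulo `π`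
  have hjac : P.jacobian = θ (jacobianMinor f le_rfl (Fin.castLE hcN)) := by
    rw [P.jacobian_eq_jacobiMatrix_det, hθ, map_jacobianMinor, Algebra.Generators.algebraMap_apply]
    congr 1
    unfold jacobianMinor
    congr 1
    refine Matrix.ext fun i j => ?_
    simp only [Matrix.of_apply, Fin.castLE_rfl, id_eq]
    rw [P.jacobiMatrix_apply, hmap, hf]
  have hunit : IsUnit (Ideal.Quotient.mk πD (Stacks07CP.Δx π f hcN)) := by
    have h := (P.jacobian_isUnit.map ε)
    rw [hjac, hεθ, hε₁, ← Stacks07CP.jacobianMinor_ιx] at h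
    exact h
  refine ⟨Stacks07CP.smooth π f hcN hunit, Stacks07CP.δ π f lam μ hμ, ε, ?_⟩
  -- compatibility
  set πΛ : Ideal Λ := (Ideal.span {π}).map (algebraMap R Λ) with hπΛ
  have hle : (Ideal.span {π ^ 2}).map (algebraMap R Λ) ≤ πΛ :=
    Ideal.map_mono (Ideal.span_singleton_le_span_singleton.mpr (dvd_pow_self π two_ne_zero))
  let red : (Λ ⧸ (Ideal.span {π ^ 2}).map (algebraMap R Λ)) →ₐ[R] Λ ⧸ πΛ :=
    Ideal.Quotient.factorₐ R hle
  let δbar : (Stacks07CP.D π f ⧸ πD) →ₐ[R] Λ ⧸ πΛ :=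
    Ideal.Quotient.liftₐ πD ((Ideal.Quotient.mkₐ R πΛ).comp (Stacks07CP.δ π f lam μ hμ)) (by
      intro a ha
      rw [hπD, Ideal.map_span, Set.image_singleton, Ideal.mem_span_singleton'] at ha
      obtain ⟨b, rfl⟩ := ha
      rw [AlgHom.comp_apply, map_mul, AlgHom.commutes, Ideal.Quotient.mkₐ_eq_mk, map_mul,
        ← Ideal.Quotient.algebraMap_eq, ← IsScalarTower.algebraMap_apply,
        IsScalarTower.algebraMap_apply R Λ (Λ ⧸ πΛ), Ideal.Quotient.algebraMap_eq,
        Ideal.Quotient.eq_zero_iff_mem.mpr (Ideal.mem_map_of_mem _ (Ideal.mem_span_singleton_self π)),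
        mul_zero])
  have hsq : δbar.comp ε = red.comp γ := by
    have h : (δbar.comp ε).comp θ = (red.comp γ).comp θ := by
      refine MvPolynomial.algHom_ext fun i => ?_
      rw [AlgHom.comp_apply, AlgHom.comp_apply, hεθ, hε₁, rename_X, AlgHom.comp_apply,
        AlgHom.comp_apply]
      change Ideal.Quotient.mk πΛ (Stacks07CP.δ π f lam μ hμ (Stacks07CP.mkD π f (X (Fin.castAdd c i)))) =
        red (γ (aeval P.val (X i)))
      rw [Stacks07CP.δ_x, aeval_X, ← hlam]
      rfl
    refine AlgHom.ext fun c₀ => ?_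
    obtain ⟨p, rfl⟩ := hθsurj c₀
    exact AlgHom.congr_fun h p
  intro c₀ d l hd hl
  have h1 : Ideal.Quotient.mk πΛ (Stacks07CP.δ π f lam μ hμ d) = δbar (Ideal.Quotient.mk πD d) := rfl
  rw [h1, hd, ← AlgHom.comp_apply, hsq, AlgHom.comp_apply, ← hl]
  rfl

/-- **Stacks, Lemma 07CP (the lifting lemma), for `C̄` smooth over `R/π²R`** — hypothesis `hCP`
of `Stacks07F5_reduceToField_of` (`NeronPopescuReduceToField.lean`), verbatim. By Lemma 07CH
(`exists_isStandardSmooth_retract_of_smooth`) `C̄` is a retract of a standard smooth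
`R/π²R`-algebra `S`, `ι : C̄ → S`, `ρ : S → C̄`; apply `Stacks07CP_of_isStandardSmooth` to
`S → C̄ → Λ/π²Λ` and precompose `ε` with `ι`. (The Noetherian and annihilator hypotheses of
07CP are not needed when `C̄` is smooth.) [cite: StacksProject, Tag 07CP] -/
theorem Stacks07CP_of_smooth :
    ∀ (R Λ : Type u) [CommRing R] [CommRing Λ] [Algebra R Λ] (π : R),
      IsNoetherianRing R →
      (∀ r : R, π ^ 2 * r = 0 → π * r = 0) →
      (∀ x : Λ, algebraMap R Λ π ^ 2 * x = 0 → algebraMap R Λ π * x = 0) →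
      ∀ (C : Type u) [CommRing C] [Algebra R C] [Algebra (R ⧸ Ideal.span {π ^ 2}) C]
        [IsScalarTower R (R ⧸ Ideal.span {π ^ 2}) C],
        Algebra.Smooth (R ⧸ Ideal.span {π ^ 2}) C →
      ∀ (γ : C →ₐ[R] Λ ⧸ (Ideal.span {π ^ 2}).map (algebraMap R Λ)),
      ∃ (D : Type u) (_ : CommRing D) (_ : Algebra R D), Algebra.Smooth R D ∧
        ∃ (δ : D →ₐ[R] Λ) (ε : C →ₐ[R] D ⧸ (Ideal.span {π}).map (algebraMap R D)),
          ∀ (c : C) (d : D) (l : Λ), Ideal.Quotient.mk _ d = ε c → Ideal.Quotient.mk _ l = γ c →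
            Ideal.Quotient.mk ((Ideal.span {π}).map (algebraMap R Λ)) (δ d) =
              Ideal.Quotient.mk ((Ideal.span {π}).map (algebraMap R Λ)) l := by
  intro R Λ _ _ _ π _ _ _ C _ _ _ _ hC γ
  haveI := hC
  obtain ⟨S, _, _, hS, ι, ρ, hρι⟩ :=
    exists_isStandardSmooth_retract_of_smooth (R ⧸ Ideal.span {π ^ 2}) C
  letI : Algebra R S :=
    ((algebraMap (R ⧸ Ideal.span {π ^ 2}) S).comp (algebraMap R (R ⧸ Ideal.span {π ^ 2}))).toAlgebra
  haveI : IsScalarTower R (R ⧸ Ideal.span {π ^ 2}) S := IsScalarTower.of_algebraMap_eq fun _ => rfl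
  haveI := hS
  obtain ⟨D, _, _, hD, δ, ε', hcomp⟩ :=
    Stacks07CP_of_isStandardSmooth π S (γ.comp (ρ.restrictScalars R))
  refine ⟨D, inferInstance, inferInstance, hD, δ, ε'.comp (ι.restrictScalars R), ?_⟩
  intro c d l hd hl
  refine hcomp (ι c) d l hd ?_
  rw [hl, AlgHom.comp_apply, AlgHom.restrictScalars_apply, ← AlgHom.comp_apply ρ ι, hρι,
    AlgHom.id_apply]

end Main

end Literature.AlgebraicGeometry.Resolution
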